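import Mathlib
import HarnessLib
import Summits.HubbardSuperconductivity.HubbardSuperconductivity.Theorems.KLProgrammeKLRegimeTwoVolumeGridCounterGluing
import Summits.HubbardSuperconductivity.HubbardSuperconductivity.Theorems.KLProgrammeKLRegimeTwoVolumeGridCounterGluingArith

/-!
# Route `KLProgramme` — crux K3, VL child `KLRegimeVolumeLimitV17F2` (stmt-HubbardSuperconductivity-20440), (vi) scale-`0` base (blueprint v4 M4):
# THE COUNTERTERM'S GLUING DEFECT AT DEEP PINS IS THE FRAME MISMATCH ONLY
# (cell gate-hubbard-kl, seat hubbard-kl-k3c4-p1 g11; `--supports` stmt-…-20440; sequel of `…TwoVolumeGridCounterGluing(Arith)`)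

For nested tori `L″ = b·L` with block structure `e` (conventions `he1/he2` of `…TwoVolumeGridGluing`) and a frame `K` of degree `< R`: at every two-leg string
with a leg on an `R`-DEEP site, the `2`-point kernel of the fine counterterm `𝒩_{K,L″,N}` EQUALS that of the glued coarse one `Σ_β (𝒩_{K,L,N} ∘ f_β)`
(`kernel_counterGlue_eq_of_deep`) — the closed-form evaluation of both structured kernels (`sum_indicator_pair_eq`, `sum_indicator_pair_glue_eq`) and the
torus arithmetic `framePosKernel_fine_eq_of_deep(_right)`.  Consequently, for TWO frames `K″` (fine volume) and `K` (coarse volume):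

* **`sum_norm_kernel_counterGlueDefect_le_of_deep`** — at an `R`-deep fine pin `w`, both slots:
  `Σ_{Y : Y p = w} ‖kernel (𝒩_{K″,L″,N} − Σ_β (𝒩_{K,L,N} ∘ f_β)) 2 Y‖ ≤ (|β|/N)·coeffNorm 0 (K″ ⊖ K)` — the `hEj` input of the scale-`0` STEP (with
  `…VolumeLimitFlowFrames*`: `coeffNorm 0 (K_{n⋆}^{(L″)} ⊖ K_{n⋆}^{(L)}) ≤ c₀(n⋆)/L`), while `…TwoVolumeGridCounterGluing.sum_norm_kernel_counterGlueDefect_le` is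
  the `hNDj` input everywhere.

Everything is proved; no definition.  References: BGM 2003 §1.2 (2.10); Salmhofer 1999 §4.2.4, §4.3.
-/

noncomputable section

namespace Summit.HubbardSuperconductivity.HubbardSuperconductivity.Theorems.TwoVolumeDefect

set_option linter.dupNamespace false -- summit = problem name (single-conjunct summit), D-0017

open Finset Literature.MathematicalPhysics.QuantumLattice GrassmannAlgebra Literature.Probability.LatticeModels
open Summit.HubbardSuperconductivity.HubbardSuperconductivity.Theorems.KLRegimeSplit

/-! ## §1 Closed forms of structured `2`-point kernels -/

section ClosedForm

variable {Γ : Type*} [DecidableEq Γ]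

/-- **The `2`-point kernel of a structured quadratic polynomial, in closed form**:
`kernel (Σ_i c_i ψ(a_i)ψ(b_i)) 2 Y = ½ Σ_i c_i ([Y₀ = a_i][Y₁ = b_i] − [Y₀ = b_i][Y₁ = a_i])`. [folklore] -/
theorem kernel_two_structured_eq {ι : Type*} (s : Finset ι) (c : ι → ℂ) (a b : ι → Γ) (Y : Fin 2 → Γ) :
    kernel ℂ (∑ i ∈ s, c i • (gen ℂ (a i) * gen ℂ (b i))) 2 Y =
      (2 : ℂ)⁻¹ * ∑ i ∈ s, c i * ((if Y 0 = a i then 1 else 0) * (if Y 1 = b i then 1 else 0) -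
        (if Y 0 = b i then 1 else 0) * (if Y 1 = a i then 1 else 0)) := by
  rw [kernel_sum, mul_sum]
  refine sum_congr rfl fun i _ => ?_
  rw [kernel_smul, kernel_two_gen_mul_gen]
  ring

end ClosedForm

section PairSums

variable {P N : ℕ} [NeZero P]

/-- **Evaluation of the pair-indicator sum of the grid counterterm's index set** (any torus `P`): for `F` on `ι = Fin 2 × (GridPoint P N × (ℤ/P)²)` with the legs
`a i = ((i.2.1, i.1), +)`, `b i = (((i.2.1.1, i.2.2), i.1), −)`:
`Σ_i F i [u = a i][v = b i] = [u is a ψ⁺ leg, v a ψ⁻ leg at the same time and spin] · F (spin u, (point u, site v))`. [folklore] -/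
theorem sum_indicator_pair_eq (F : Fin 2 × (GridPoint P N × TorusSite 2 P) → ℂ) (u v : GridLeg (GridPoint P N)) :
    ∑ i : Fin 2 × (GridPoint P N × TorusSite 2 P),
        F i * ((if u = (((i.2.1, i.1), 0) : GridLeg (GridPoint P N)) then (1 : ℂ) else 0) *
          (if v = ((((i.2.1.1, i.2.2), i.1), 1) : GridLeg (GridPoint P N)) then (1 : ℂ) else 0)) =
      if (u.2 = 0 ∧ v.2 = 1 ∧ v.1.1.1 = u.1.1.1 ∧ v.1.2 = u.1.2) then F (u.1.2, (u.1.1, v.1.1.2)) else 0 := by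
  classical
  set i₀ : Fin 2 × (GridPoint P N × TorusSite 2 P) := (u.1.2, (u.1.1, v.1.1.2)) with hi₀
  rw [Finset.sum_eq_single i₀]
  · -- the candidate term
    have ha : (u = (((i₀.2.1, i₀.1), 0) : GridLeg (GridPoint P N))) ↔ u.2 = 0 := by
      constructor
      · intro h; rw [h]
      · intro h; rw [hi₀]; ext <;> simp [h]
    have hb : (v = ((((i₀.2.1.1, i₀.2.2), i₀.1), 1) : GridLeg (GridPoint P N))) ↔ (v.2 = 1 ∧ v.1.1.1 = u.1.1.1 ∧ v.1.2 = u.1.2) := by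
      constructor
      · intro h
        refine ⟨by rw [h], by rw [h], by rw [h]⟩
      · rintro ⟨h1, h2, h3⟩; rw [hi₀]; ext <;> simp [h1, h2, h3]
    by_cases hu : u.2 = 0
    · by_cases hv : v.2 = 1 ∧ v.1.1.1 = u.1.1.1 ∧ v.1.2 = u.1.2
      · rw [if_pos (ha.2 hu), if_pos (hb.2 hv), if_pos ⟨hu, hv⟩, mul_one, mul_one]
      · rw [if_neg (fun h => hv (hb.1 h)), mul_zero, mul_zero, if_neg (fun h => hv h.2)]
    · rw [if_neg (fun h => hu (ha.1 h)), zero_mul, mul_zero, if_neg (fun h => hu h.1)]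
  · -- every other term vanishes
    intro i _ hi
    by_cases h1 : u = (((i.2.1, i.1), 0) : GridLeg (GridPoint P N))
    · by_cases h2 : v = ((((i.2.1.1, i.2.2), i.1), 1) : GridLeg (GridPoint P N))
      · exfalso; apply hi
        rw [hi₀, h1, h2]
      · rw [if_neg h2, mul_zero, mul_zero]
    · rw [if_neg h1, zero_mul, mul_zero]
  · exact fun h => (h (mem_univ _)).elim

end PairSums

/-! ## §2 The fine and the glued counterterm kernels agree at strings with a deep leg -/

section Blocks

variable {b L Lf N : ℕ}

/-- Two fine legs lie in the same block iff their block labels agree. [folklore] -/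
theorem block_eq_iff (e : GridLeg (GridPoint Lf N) ≃ (Fin 2 → Fin b) × GridLeg (GridPoint L N))
    (he1 : ∀ X' i, ((e X').1 i : ℕ) = (X'.1.1.2 i).val / L) (u v : GridLeg (GridPoint Lf N)) :
    (e u).1 = (e v).1 ↔ ∀ k, (u.1.1.2 k).val / L = (v.1.1.2 k).val / L := by
  constructor
  · intro h k
    rw [← he1 u k, ← he1 v k, h]
  · intro h
    funext k
    exact Fin.ext (by rw [he1, he1, h k])

end Blocks

section Deep

variable {b L Lf N : ℕ} [NeZero Lf] [NeZero L]
  (e : GridLeg (GridPoint Lf N) ≃ (Fin 2 → Fin b) × GridLeg (GridPoint L N))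
  (he1 : ∀ X' i, ((e X').1 i : ℕ) = (X'.1.1.2 i).val / L)
  (he2 : ∀ X', (e X').2 = (((X'.1.1.1, fun i => (((X'.1.1.2 i).val : ℕ) : ZMod L)), X'.1.2), X'.2))
  (Fe : (Fin 2 → Fin b) → (GridLeg (GridPoint L N) → ℂ) →ₗ[ℂ] (GridLeg (GridPoint Lf N) → ℂ))
  (hFe : ∀ β v X', Fe β v X' = if (e X').1 = β then v (e X').2 else 0)

omit [NeZero Lf] in
/-- **Evaluation of the pair-indicator sum of the GLUED index set**: the glued term at `(β, i)` hits the fine pair `(u, v)` iff both legs lie in block `β` and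
the projected coarse pair is hit by `i`; the value is the coarse coefficient at the projected pair. [folklore] -/
theorem sum_indicator_pair_glue_eq (G : Fin 2 × (GridPoint L N × TorusSite 2 L) → ℂ) (u v : GridLeg (GridPoint Lf N)) :
    ∑ j : (Fin 2 → Fin b) × (Fin 2 × (GridPoint L N × TorusSite 2 L)),
        G j.2 * ((if u = e.symm (j.1, (((j.2.2.1, j.2.1), 0) : GridLeg (GridPoint L N))) then (1 : ℂ) else 0) *
          (if v = e.symm (j.1, ((((j.2.2.1.1, j.2.2.2), j.2.1), 1) : GridLeg (GridPoint L N))) then (1 : ℂ) else 0)) =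
      if ((e u).1 = (e v).1 ∧ ((e u).2.2 = 0 ∧ (e v).2.2 = 1 ∧ (e v).2.1.1.1 = (e u).2.1.1.1 ∧ (e v).2.1.2 = (e u).2.1.2)) then
        G ((e u).2.1.2, ((e u).2.1.1, (e v).2.1.1.2)) else 0 := by
  classical
  -- rewrite the fine indicators as indicators on the block label and the projected coarse legs
  have hind : ∀ (β : Fin 2 → Fin b) (Y : GridLeg (GridPoint L N)) (x : GridLeg (GridPoint Lf N)),
      (if x = e.symm (β, Y) then (1 : ℂ) else 0) = (if (e x).1 = β then (1 : ℂ) else 0) * (if (e x).2 = Y then (1 : ℂ) else 0) := by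
    intro β Y x
    by_cases h : x = e.symm (β, Y)
    · rw [if_pos h, h, Equiv.apply_symm_apply, if_pos rfl, if_pos rfl, mul_one]
    · have h' : ¬ ((e x).1 = β ∧ (e x).2 = Y) := by
        rintro ⟨h1, h2⟩
        exact h (by rw [Equiv.eq_symm_apply]; exact Prod.ext h1 h2)
      rw [if_neg h]
      by_cases h1 : (e x).1 = β
      · rw [if_pos h1, if_neg (fun h2 => h' ⟨h1, h2⟩), mul_zero]
      · rw [if_neg h1, zero_mul]
  simp_rw [hind]
  rw [Fintype.sum_prod_type]
  -- the block sum selects `β = (e u).1`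
  have hblk : ∀ β : Fin 2 → Fin b, ∑ i : Fin 2 × (GridPoint L N × TorusSite 2 L),
      G i * (((if (e u).1 = β then (1 : ℂ) else 0) * (if (e u).2 = (((i.2.1, i.1), 0) : GridLeg (GridPoint L N)) then (1 : ℂ) else 0)) *
        ((if (e v).1 = β then (1 : ℂ) else 0) * (if (e v).2 = ((((i.2.1.1, i.2.2), i.1), 1) : GridLeg (GridPoint L N)) then (1 : ℂ) else 0))) =
      (if (e u).1 = β then (1 : ℂ) else 0) * (if (e v).1 = β then (1 : ℂ) else 0) *
        ∑ i : Fin 2 × (GridPoint L N × TorusSite 2 L),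
          G i * ((if (e u).2 = (((i.2.1, i.1), 0) : GridLeg (GridPoint L N)) then (1 : ℂ) else 0) *
            (if (e v).2 = ((((i.2.1.1, i.2.2), i.1), 1) : GridLeg (GridPoint L N)) then (1 : ℂ) else 0)) := by
    intro β
    rw [mul_sum]
    exact sum_congr rfl fun i _ => by ring
  simp_rw [hblk, sum_indicator_pair_eq G (e u).2 (e v).2]
  rw [Finset.sum_eq_single (e u).1]
  · rw [if_pos rfl, one_mul]
    by_cases hb : (e u).1 = (e v).1
    · rw [← hb, if_pos rfl, one_mul]
      by_cases hm : (e u).2.2 = 0 ∧ (e v).2.2 = 1 ∧ (e v).2.1.1.1 = (e u).2.1.1.1 ∧ (e v).2.1.2 = (e u).2.1.2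
      · rw [if_pos hm, if_pos ⟨rfl, hm⟩]
      · rw [if_neg hm, if_neg (fun h => hm h.2)]
    · rw [if_neg (Ne.symm hb), zero_mul, if_neg (fun h => hb h.1)]
  · intro β _ hβ
    rw [if_neg (Ne.symm hβ), zero_mul, zero_mul]
  · exact fun h => (h (mem_univ _)).elim

include he1 he2 hFe in
/-- **FINE AND GLUED COUNTERTERM KERNELS AGREE AT STRINGS WITH A DEEP LEG**: for `L″ = b·L`, `K.degree < R`, and a two-leg string `Y` one of whose legs sits on
an `R`-deep site, `kernel 𝒩_{K,L″,N} 2 Y = kernel (Σ_β 𝒩_{K,L,N} ∘ f_β) 2 Y`. [folklore] -/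
theorem kernel_counterGlue_eq_of_deep (hLf : Lf = b * L) (β' : ℝ) (K : TrigPolyC4v) {R : ℕ} (hR : K.degree < R)
    (Y : Fin 2 → GridLeg (GridPoint Lf N))
    (hY : (∀ k, R ≤ ((Y 0).1.1.2 k).val % L ∧ ((Y 0).1.1.2 k).val % L + R < L) ∨
      (∀ k, R ≤ ((Y 1).1.1.2 k).val % L ∧ ((Y 1).1.1.2 k).val % L + R < L)) :
    kernel ℂ (hubbardGridCounterQuadratic Lf N β' K) 2 Y =
      kernel ℂ (∑ β, ExteriorAlgebra.map (Fe β) (hubbardGridCounterQuadratic L N β' K)) 2 Y := by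
  classical
  rw [hubbardGridCounterQuadratic_eq_sum, sum_map_blockEmb_hubbardGridCounterQuadratic_eq e Fe hFe, kernel_two_structured_eq, kernel_two_structured_eq]
  congr 1
  simp_rw [mul_sub]
  rw [sum_sub_distrib, sum_sub_distrib]
  -- the reduced (projected) data of a fine leg
  have hproj : ∀ x : GridLeg (GridPoint Lf N), (e x).2.2 = x.2 ∧ (e x).2.1.2 = x.1.2 ∧ (e x).2.1.1.1 = x.1.1.1 ∧
      (e x).2.1.1.2 = fun k => (((x.1.1.2 k).val : ℕ) : ZMod L) := fun x => by rw [he2]; exact ⟨rfl, rfl, rfl, rfl⟩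
  -- both orientations of the pair `(Y 0, Y 1)` at once: for fine legs `u, v` one of which sits on a deep site
  have key : ∀ (u v : GridLeg (GridPoint Lf N)),
      ((∀ k, R ≤ (u.1.1.2 k).val % L ∧ (u.1.1.2 k).val % L + R < L) ∨ (∀ k, R ≤ (v.1.1.2 k).val % L ∧ (v.1.1.2 k).val % L + R < L)) →
      ∑ i : Fin 2 × (GridPoint Lf N × TorusSite 2 Lf),
          ((((β' / N : ℝ)) : ℂ) * framePosKernel Lf K (i.2.1.2 - i.2.2)) *
            ((if u = (((i.2.1, i.1), 0) : GridLeg (GridPoint Lf N)) then (1 : ℂ) else 0) *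
              (if v = ((((i.2.1.1, i.2.2), i.1), 1) : GridLeg (GridPoint Lf N)) then (1 : ℂ) else 0)) =
        ∑ j : (Fin 2 → Fin b) × (Fin 2 × (GridPoint L N × TorusSite 2 L)),
          ((((β' / N : ℝ)) : ℂ) * framePosKernel L K (j.2.2.1.2 - j.2.2.2)) *
            ((if u = e.symm (j.1, (((j.2.2.1, j.2.1), 0) : GridLeg (GridPoint L N))) then (1 : ℂ) else 0) *
              (if v = e.symm (j.1, ((((j.2.2.1.1, j.2.2.2), j.2.1), 1) : GridLeg (GridPoint L N))) then (1 : ℂ) else 0)) := by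
    intro u v huv
    have hF := sum_indicator_pair_eq (fun i : Fin 2 × (GridPoint Lf N × TorusSite 2 Lf) =>
      (((β' / N : ℝ)) : ℂ) * framePosKernel Lf K (i.2.1.2 - i.2.2)) u v
    have hG := sum_indicator_pair_glue_eq e (fun i : Fin 2 × (GridPoint L N × TorusSite 2 L) =>
      (((β' / N : ℝ)) : ℂ) * framePosKernel L K (i.2.1.2 - i.2.2)) u v
    simp only [] at hF hG
    rw [hF, hG]
    obtain ⟨hu2, hus, hut, hux⟩ := hproj u
    obtain ⟨hv2, hvs, hvt, hvx⟩ := hproj v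
    have hC : ((e u).1 = (e v).1 ∧ ((e u).2.2 = 0 ∧ (e v).2.2 = 1 ∧ (e v).2.1.1.1 = (e u).2.1.1.1 ∧ (e v).2.1.2 = (e u).2.1.2)) ↔
        ((∀ k, (u.1.1.2 k).val / L = (v.1.1.2 k).val / L) ∧ (u.2 = 0 ∧ v.2 = 1 ∧ v.1.1.1 = u.1.1.1 ∧ v.1.2 = u.1.2)) := by
      rw [block_eq_iff e he1 u v, hu2, hv2, hus, hvs, hut, hvt]
    rw [hux, hvx]
    simp only [hC]
    by_cases hm : u.2 = 0 ∧ v.2 = 1 ∧ v.1.1.1 = u.1.1.1 ∧ v.1.2 = u.1.2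
    · -- the deep arithmetic: the fine coefficient is the block-indicator times the coarse one
      rcases huv with hu | hv
      · rw [framePosKernel_fine_eq_of_deep hLf K hR u.1.1.2 v.1.1.2 hu]
        by_cases hb : ∀ k, (u.1.1.2 k).val / L = (v.1.1.2 k).val / L
        · rw [if_pos (show ∀ i, (v.1.1.2 i).val / L = (u.1.1.2 i).val / L from fun i => (hb i).symm), if_pos hm,
            if_pos (And.intro hb hm)]
        · rw [if_neg (show ¬ ∀ i, (v.1.1.2 i).val / L = (u.1.1.2 i).val / L from fun h => hb fun k => (h k).symm), mul_zero,
            ite_self, if_neg (show ¬ ((∀ k, (u.1.1.2 k).val / L = (v.1.1.2 k).val / L) ∧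
              (u.2 = 0 ∧ v.2 = 1 ∧ v.1.1.1 = u.1.1.1 ∧ v.1.2 = u.1.2)) from fun h => hb h.1)]
      · rw [framePosKernel_fine_eq_of_deep_right hLf K hR u.1.1.2 v.1.1.2 hv]
        by_cases hb : ∀ k, (u.1.1.2 k).val / L = (v.1.1.2 k).val / L
        · rw [if_pos hb, if_pos hm, if_pos (And.intro hb hm)]
        · rw [if_neg hb, mul_zero, ite_self, if_neg (show ¬ ((∀ k, (u.1.1.2 k).val / L = (v.1.1.2 k).val / L) ∧
              (u.2 = 0 ∧ v.2 = 1 ∧ v.1.1.1 = u.1.1.1 ∧ v.1.2 = u.1.2)) from fun h => hb h.1)]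
    · rw [if_neg hm, if_neg (show ¬ ((∀ k, (u.1.1.2 k).val / L = (v.1.1.2 k).val / L) ∧
          (u.2 = 0 ∧ v.2 = 1 ∧ v.1.1.1 = u.1.1.1 ∧ v.1.2 = u.1.2)) from fun h => hm h.2)]
  rw [key (Y 0) (Y 1) hY]
  congr 1
  -- the swapped orientation: reorder the factors and apply `key` to `(Y 1, Y 0)`
  have hswapf : ∀ i : Fin 2 × (GridPoint Lf N × TorusSite 2 Lf),
      ((((β' / N : ℝ)) : ℂ) * framePosKernel Lf K (i.2.1.2 - i.2.2)) *
          ((if Y 0 = ((((i.2.1.1, i.2.2), i.1), 1) : GridLeg (GridPoint Lf N)) then (1 : ℂ) else 0) *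
            (if Y 1 = (((i.2.1, i.1), 0) : GridLeg (GridPoint Lf N)) then (1 : ℂ) else 0)) =
        ((((β' / N : ℝ)) : ℂ) * framePosKernel Lf K (i.2.1.2 - i.2.2)) *
          ((if Y 1 = (((i.2.1, i.1), 0) : GridLeg (GridPoint Lf N)) then (1 : ℂ) else 0) *
            (if Y 0 = ((((i.2.1.1, i.2.2), i.1), 1) : GridLeg (GridPoint Lf N)) then (1 : ℂ) else 0)) := fun i => by ring
  have hswapg : ∀ j : (Fin 2 → Fin b) × (Fin 2 × (GridPoint L N × TorusSite 2 L)),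
      ((((β' / N : ℝ)) : ℂ) * framePosKernel L K (j.2.2.1.2 - j.2.2.2)) *
          ((if Y 0 = e.symm (j.1, ((((j.2.2.1.1, j.2.2.2), j.2.1), 1) : GridLeg (GridPoint L N))) then (1 : ℂ) else 0) *
            (if Y 1 = e.symm (j.1, (((j.2.2.1, j.2.1), 0) : GridLeg (GridPoint L N))) then (1 : ℂ) else 0)) =
        ((((β' / N : ℝ)) : ℂ) * framePosKernel L K (j.2.2.1.2 - j.2.2.2)) *
          ((if Y 1 = e.symm (j.1, (((j.2.2.1, j.2.1), 0) : GridLeg (GridPoint L N))) then (1 : ℂ) else 0) *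
            (if Y 0 = e.symm (j.1, ((((j.2.2.1.1, j.2.2.2), j.2.1), 1) : GridLeg (GridPoint L N))) then (1 : ℂ) else 0)) :=
    fun j => by ring
  simp_rw [hswapf, hswapg]
  exact key (Y 1) (Y 0) hY.symm

include he1 he2 hFe in
/-- **AT A DEEP PIN THE COUNTERTERM GLUING DEFECT IS THE FRAME MISMATCH ONLY**: for `L″ = b·L`, `K.degree < R` and a fine leg `w` on an `R`-deep site, both
slots `p`: `Σ_{Y : Y p = w} ‖kernel (𝒩_{K″,L″,N} − Σ_β (𝒩_{K,L,N} ∘ f_β)) 2 Y‖ ≤ (|β|/N)·coeffNorm 0 (K″ ⊖ K)`. [folklore] -/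
theorem sum_norm_kernel_counterGlueDefect_le_of_deep (hLf : Lf = b * L) (β' : ℝ) (K K'' : TrigPolyC4v) {R : ℕ} (hR : K.degree < R)
    (p : Fin 2) (w : GridLeg (GridPoint Lf N)) (hw : ∀ k, R ≤ (w.1.1.2 k).val % L ∧ (w.1.1.2 k).val % L + R < L) :
    ∑ Y ∈ univ.filter (fun Y : Fin 2 → GridLeg (GridPoint Lf N) => Y p = w),
      ‖kernel ℂ (hubbardGridCounterQuadratic Lf N β' K'' - ∑ β, ExteriorAlgebra.map (Fe β) (hubbardGridCounterQuadratic L N β' K)) 2 Y‖ ≤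
        |β'| / N * (fsub K'' K).coeffNorm 0 := by
  classical
  -- split off the frame mismatch: `𝒩″_f − Glue 𝒩_c = 𝒩_f(K″ ⊖ K) + (𝒩_f(K) − Glue 𝒩_c(K))`
  have hsplit : hubbardGridCounterQuadratic Lf N β' K'' - ∑ β, ExteriorAlgebra.map (Fe β) (hubbardGridCounterQuadratic L N β' K) =
      hubbardGridCounterQuadratic Lf N β' (fsub K'' K) +
        (hubbardGridCounterQuadratic Lf N β' K - ∑ β, ExteriorAlgebra.map (Fe β) (hubbardGridCounterQuadratic L N β' K)) := by
    rw [hubbardGridCounterQuadratic_fsub]; abel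
  -- the equal-frame defect has vanishing kernels at strings through the deep pin
  have hvan : ∀ Y ∈ univ.filter (fun Y : Fin 2 → GridLeg (GridPoint Lf N) => Y p = w),
      kernel ℂ (hubbardGridCounterQuadratic Lf N β' K - ∑ β, ExteriorAlgebra.map (Fe β) (hubbardGridCounterQuadratic L N β' K)) 2 Y = 0 := by
    intro Y hY
    have hYp : Y p = w := (mem_filter.1 hY).2
    have hdeep : (∀ k, R ≤ ((Y 0).1.1.2 k).val % L ∧ ((Y 0).1.1.2 k).val % L + R < L) ∨
        (∀ k, R ≤ ((Y 1).1.1.2 k).val % L ∧ ((Y 1).1.1.2 k).val % L + R < L) := by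
      fin_cases p
      · left; rw [show Y 0 = w from hYp]; exact hw
      · right; rw [show Y 1 = w from hYp]; exact hw
    rw [sub_eq_add_neg, kernel_add, ← neg_one_smul ℂ (∑ β, ExteriorAlgebra.map (Fe β) (hubbardGridCounterQuadratic L N β' K)), kernel_smul,
      kernel_counterGlue_eq_of_deep e he1 he2 Fe hFe hLf β' K hR Y hdeep]
    ring
  calc ∑ Y ∈ univ.filter (fun Y : Fin 2 → GridLeg (GridPoint Lf N) => Y p = w),
        ‖kernel ℂ (hubbardGridCounterQuadratic Lf N β' K'' - ∑ β, ExteriorAlgebra.map (Fe β) (hubbardGridCounterQuadratic L N β' K)) 2 Y‖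
      = ∑ Y ∈ univ.filter (fun Y : Fin 2 → GridLeg (GridPoint Lf N) => Y p = w),
          ‖kernel ℂ (hubbardGridCounterQuadratic Lf N β' (fsub K'' K)) 2 Y‖ := by
        refine sum_congr rfl fun Y hY => ?_
        rw [hsplit, kernel_add, hvan Y hY, add_zero]
    _ ≤ |β'| / N * (fsub K'' K).coeffNorm 0 := sum_norm_kernel_hubbardGridCounterQuadratic_le β' (fsub K'' K) p w

end Deep

end Summit.HubbardSuperconductivity.HubbardSuperconductivity.Theorems.TwoVolumeDefect

end
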